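/-
Copyright (c) 2026. All rights reserved.
Released under Apache 2.0 license as described in the file LICENSE.
Authors: abc-iut cell, seat abc-iut-f-197 (block F fact-proving wave, tranche 197; proof-only companion of
abc-iut-L6-t3's `LocalLogShells.lean`).
-/
import Literature.IUT.LogVolume.AdicCompletionLogShell
import Literature.IUT.LogThetaLattice.LocalLogShellsSchemaNegative
import HarnessLib

/-!
# [IUTchIII] Rmk 1.2.2 (i) (b^non): the FACT-LIST row `IntegersSubsetLogShell` at THE named instances — `_holds`

Mochizuki, *Inter-universal Teichmüller Theory III*, kurims manuscript (May 2020), Remark 1.2.2 (i) p. 36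
("the evident inclusions `O_k^▷ := O_k \ {0} ⊆ O_k ⊆ I_k`", `I_k := (p_v^*)⁻¹ · log_k(O_k^×)`, `k = K_v` an MLF,
`log_k` the `p_v`-adic logarithm) [cite: Mochizuki2012, III Rmk 1.2.2 (i) p.36]; classically [AbsTopIII]
Def. 5.4 (iii) / Neukirch, *Algebraic Number Theory*, Ch. II Prop. (5.5) (the logarithm maps `1 + p^* O`
onto `p^* O`).  D-0012 claim key, status disputed — the item is a classical local fact the text RECALLS; this
file takes no side on [IUTchIII] Cor. 3.12 and asserts nothing about abc.

PROOF-ONLY companion (cell abc-iut, seat abc-iut-f-197, F fact-proving wave, FROZEN FACT-LIST row **F-2612**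
`IntegersSubsetLogShell` (structure); no definition, no statement re-typed; the declaring file
`LocalLogShells.lean` (abc-iut-L6-t3) is imported — through its discharge companions — never edited).

The row is a SCHEMA over an ARBITRARY additive homomorphism `logk : O^× → k` (plan rule R5): its universal
closure is FALSE (`not_integersSubsetLogShell_zero` / `not_forall_integersSubsetLogShell`, abc-iut-w5-d182,
`LocalLogShellsSchemaNegative.lean`: `logk = 0` gives `I_k = {0} ∌ 1`), so it is consumable AT NAMED INSTANCES
ONLY.  THE instance the text prints and the cone consumes is the completion `K_v` of a number field `F` at a
finite place `v`, its ring of integers `O_v`, and THE analytic `p_v`-adic logarithm on `O_v^×` — in the tree: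
abc-iut-S1's `unitLog` evaluated in abc-iut-S7's rescaled field `RescaledCompletion F p_v v` (same elements as
`K_v`), which is exactly the formula clause `Summit.ABC.IUTFork.Thm311.Real.analyticLogv_apply` of the cone's
law-abiding family `Real.analyticLogv F` (abc-iut-c312-5, `Thm311RealLog.lean`; law `Real.LogvLaw` =
`∀ v, IntegersSubsetLogShell O_v (logv v) p_v`).  This file records, BY NAME from landed theorems:

* `integersSubsetLogShell_holds` — **F-2612 HOLDS at THE instance**: for EVERY number field `F`, EVERY finite
  place `v` and EVERY additive `logk : O_v^× → K_v` given by the analytic formula (the hypothesis pins `logk`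
  down as THE `p_v`-adic logarithm; it is the formula clause of `analyticLogv_apply`, so the cone's
  `Real.analyticLogv F v` is covered verbatim), `IntegersSubsetLogShell O_v logk p_v` — abc-iut-L3-t11's
  discharge `integersSubsetLogShell_of_eq_unitLog` run in the rescaled field (abc-iut-L5-t5's
  `mem_integers_iff_norm_rescaled_le_one` supplies `O_v = {‖x‖ ≤ 1}`), read back in `K_v` along the identity;
* `integersSubsetLogShell_holds_of_mem` — the same at ANY prime `p` lying under `v` (`(p) ⊆ 𝔭_v`), for the
  `p`-adic logarithm in `RescaledCompletion F p v`;
* `integersSubsetLogShell_holds_iff_not_schema` — the R5 record in one line: at every `(F, v)` the instance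
  form holds for the analytic logarithm AND fails for `logk = 0` (so no universal form is a fact).

Fully-qualified types throughout (FQ-TYPE RULE).  Nothing here is new mathematics.
-/

noncomputable section

namespace Literature.IUT.LogThetaLattice

open NumberField IsDedekindDomain Literature.IUT.LogVolume Literature.NumberTheory.NumberFields

variable (F : Type) [Field F] [NumberField F] (v : HeightOneSpectrum (𝓞 F))

/-- **FACT-LIST row F-2612 `IntegersSubsetLogShell` HOLDS at THE named instance, any prime `p` under `v`**
([IUTchIII] Rmk 1.2.2 (i) (b^non) p. 36, "`O_k ⊆ I_k`"): for the completion `K_v` of a number field `F` at a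
finite place `v`, a prime `p` with `(p) ⊆ 𝔭_v`, and ANY additive `logk : O_v^× → K_v` given by the analytic
formula `logk u = log_p u` (abc-iut-S1's `unitLog` in abc-iut-S7's rescaled field `RescaledCompletion F p v`,
read back in `K_v` along the identity `RescaledCompletion.of`), `O_v ⊆ I_v := (p^*)⁻¹ · logk(O_v^×)`.
Proof: abc-iut-L3-t11's `integersSubsetLogShell_of_eq_unitLog` in the rescaled field, whose closed unit ball
is `O_v` (`mem_integers_iff_norm_rescaled_le_one`). [cite: Mochizuki2012, III Rmk 1.2.2 (i) p.36] -/
theorem integersSubsetLogShell_holds_of_mem (p : ℕ) [Fact p.Prime] (hv : ((p : ℕ) : 𝓞 F) ∈ v.asIdeal)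
    (logk : Additive (↥(v.adicCompletionIntegers F))ˣ →+ v.adicCompletion F)
    (hlog : ∀ u : (↥(v.adicCompletionIntegers F))ˣ, logk (Additive.ofMul u) =
      (RescaledCompletion.of F p v hv).symm
        (unitLog (RescaledCompletion.of F p v hv
          (((u : ↥(v.adicCompletionIntegers F)) : v.adicCompletion F))))) :
    Literature.IUT.LogThetaLattice.IntegersSubsetLogShell (v.adicCompletionIntegers F) logk p :=
  integersSubsetLogShell_of_eq_unitLog p (K := RescaledCompletion F p v hv)
    (v.adicCompletionIntegers F : ValuationSubring (RescaledCompletion F p v hv))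
    (mem_integers_iff_norm_rescaled_le_one F p v hv) logk hlog

/-- **FACT-LIST row F-2612 `IntegersSubsetLogShell` HOLDS at THE named instance** ([IUTchIII] Rmk 1.2.2 (i)
(b^non) p. 36: `k := K_v`, `log_k : O_k^× → k` the `p_v`-adic logarithm, "the evident inclusions
`O_k^▷ := O_k \ {0} ⊆ O_k ⊆ I_k`" with `I_k := (p_v^*)⁻¹ · log_k(O_k^×)`): for EVERY number field `F`, EVERY
finite place `v` (residue characteristic `p_v = residueChar F v`) and EVERY additive `logk : O_v^× → K_v` given
by the analytic formula — verbatim the formula clause `Summit.ABC.IUTFork.Thm311.Real.analyticLogv_apply` of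
the cone's family `Real.analyticLogv F`, so `Real.logvLaw_analyticLogv` is this theorem at `analyticLogv F v` —
`IntegersSubsetLogShell O_v logk p_v`.  R5: instance form; the universal closure over arbitrary `logk` is false
(`not_integersSubsetLogShell_zero`, abc-iut-w5-d182). [cite: Mochizuki2012, III Rmk 1.2.2 (i) p.36] -/
theorem integersSubsetLogShell_holds
    (logk : Additive (↥(v.adicCompletionIntegers F))ˣ →+ v.adicCompletion F)
    (hlog : ∀ u : (↥(v.adicCompletionIntegers F))ˣ, logk (Additive.ofMul u) =
      (RescaledCompletion.of F (residueChar F v) v (natCast_residueChar_mem F v)).symm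
        (haveI : Fact (residueChar F v).Prime := ⟨residueChar_prime F v⟩
         unitLog (RescaledCompletion.of F (residueChar F v) v (natCast_residueChar_mem F v)
          (((u : ↥(v.adicCompletionIntegers F)) : v.adicCompletion F))))) :
    Literature.IUT.LogThetaLattice.IntegersSubsetLogShell (v.adicCompletionIntegers F) logk
      (residueChar F v) :=
  haveI : Fact (residueChar F v).Prime := ⟨residueChar_prime F v⟩
  integersSubsetLogShell_holds_of_mem F v (residueChar F v) (natCast_residueChar_mem F v) logk hlog

/-- **F-2612 is inhabited at THE instance with no hypothesis left over**: at every finite place `v` of every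
number field `F` there IS an additive `logk : O_v^× → K_v` given by the analytic formula (abc-iut-L5-t5's
`exists_unitLog_integersSubsetLogShell_residueChar`, first clause), and for it `IntegersSubsetLogShell O_v logk
p_v` holds by `integersSubsetLogShell_holds` — so the formula hypothesis of `integersSubsetLogShell_holds` is
satisfiable and the row is witnessed at THE instance, not merely reduced.
[cite: Mochizuki2012, III Rmk 1.2.2 (i) p.36] -/
theorem exists_formula_and_integersSubsetLogShell_holds :
    ∃ logk : Additive (↥(v.adicCompletionIntegers F))ˣ →+ v.adicCompletion F,
      (∀ u : (↥(v.adicCompletionIntegers F))ˣ, logk (Additive.ofMul u) =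
        (RescaledCompletion.of F (residueChar F v) v (natCast_residueChar_mem F v)).symm
          (haveI : Fact (residueChar F v).Prime := ⟨residueChar_prime F v⟩
           unitLog (RescaledCompletion.of F (residueChar F v) v (natCast_residueChar_mem F v)
            (((u : ↥(v.adicCompletionIntegers F)) : v.adicCompletion F))))) ∧
      Literature.IUT.LogThetaLattice.IntegersSubsetLogShell (v.adicCompletionIntegers F) logk
        (residueChar F v) := by
  obtain ⟨logk, hlog, -⟩ := exists_unitLog_integersSubsetLogShell_residueChar F v
  exact ⟨logk, hlog, integersSubsetLogShell_holds F v logk hlog⟩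

/-- **R5 record for F-2612 at THE carrier `(K_v, O_v, p_v)`**: the instance form holds for the analytic
logarithm (`exists_formula_and_integersSubsetLogShell_holds`) while the schema fails for `logk = 0` on the
SAME carrier (abc-iut-w5-d182's `not_integersSubsetLogShell_zero`) — so `IntegersSubsetLogShell O_v · p_v` is a
genuine constraint on `logk`, consumable only at the named logarithm, never as a universal closure.
[cite: Mochizuki2012, III Rmk 1.2.2 (i) p.36] -/
theorem integersSubsetLogShell_holds_and_not_schema :
    (∃ logk : Additive (↥(v.adicCompletionIntegers F))ˣ →+ v.adicCompletion F,
        Literature.IUT.LogThetaLattice.IntegersSubsetLogShell (v.adicCompletionIntegers F) logk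
          (residueChar F v)) ∧
      ¬ ∀ logk : Additive (↥(v.adicCompletionIntegers F))ˣ →+ v.adicCompletion F,
        Literature.IUT.LogThetaLattice.IntegersSubsetLogShell (v.adicCompletionIntegers F) logk
          (residueChar F v) := by
  refine ⟨?_, fun h => not_integersSubsetLogShell_zero _ (residueChar F v) (h 0)⟩
  obtain ⟨logk, -, hI⟩ := exists_formula_and_integersSubsetLogShell_holds F v
  exact ⟨logk, hI⟩

end Literature.IUT.LogThetaLattice

end
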